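import Summits.CriticalPhenomena.PercolationContinuityZ3.Theorems.PercNearOneGluingAdditiveGluingGoodStepResidual
import HarnessLib

/-! # Crux `PercNearOneGluing.AdditiveGluing` (stmt-CriticalPhenomena-4576), stub `stub_goodStep` — reduction to the residual
# kernel WITH THE INDUCTION HYPOTHESIS INSIDE (`goodStep_of_residualKernelIH`)

Invested seat `xfam-b` (cross-family direct attempt B on `residualKernel_two`); lands `--supports stmt-CriticalPhenomena-4576`;
no definitions, no named facts.

The landed capstone `goodStep_of_residualKernel` (file `…GoodStepResidual.lean`) reduces the inductive step `stub_goodStep` to a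
residual kernel `hres` that must be proved FROM SCRATCH: `hres` quantifies over all weightings `u` and carries no induction
hypothesis, although at its only call site the induction hypothesis `IH` of `stub_goodStep` is in scope and applies to `u` itself
(`u` = the weighting `w` with the star of the observer `o` killed, which has fewer positive-degree vertices than `w`,
`goodStep24_card_lt`), to every partial gluing `u + p·xy` of the block, to every deletion `u ∖ W` and to every quotient of `u`.
Read as a goodness statement in the glued graph `u/S`, `hres` asks for goodness of the glued vertex `s*` at the level
`μ_{u/S}(a₀ ↔ b)` of the PRE-gluing minimiser `a₀`, which under drift is STRICTLY above `min_A μ_{u/S}(· ↔ b)` — i.e. `hres` is a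
strengthening of the Question-7-type goodness of `s*` in `u/S`, and a standalone proof of it would have to re-derive that
conjectural content with no induction available.

**`goodStep_of_residualKernelIH`** is the same reduction with the WEAKER residual hypothesis `hresIH`: the kernel may in
addition assume (`hIH`) that every quadruple `(w', A', o', b')` with `b' ∈ A' ∌ o'` is good whenever `w'` has at most as many
positive-degree vertices as `u`.  At the call site `hIH` is discharged by `IH` through `goodStep24_card_lt`.  With `hIH` the
residual kernel becomes an honest gluing step — the goodness analogue of Kozma–Nitzan's edge-shortening Conjecture 6 for an
edge between two bad vertices (the conclusion is affine in the weight of the pair `xy`, and `hIH` gives it at the un-glued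
weight) — instead of a from-scratch strengthening of the conjecture.  `residualKernelIH_of_residualKernel` records that the new
hypothesis is implied by the old one, so a lead loses nothing by registering the IH-form as the named stub.
[cite: KozmaNitzan2024, §3.2 (Thms 4–5 pp. 12–14), §5.3 (Conjecture 6, Lemma 13, p. 34), Question 7 (p. 36)]
-/

namespace Summit.CriticalPhenomena.PercolationContinuityZ3.Theorems

open MeasureTheory Set
open Literature.Probability.LatticeModels (prodBernoulli)
open Literature.Probability.Percolation (BondConfig openConn openConnIn openGraph openCluster)
open scoped BigOperators

noncomputable section
open Classical

section ResidualIH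

open Literature.Probability.LatticeModels Literature.Probability.Percolation

variable {n : ℕ}

/-- **`stub_goodStep` from the residual kernel WITH induction hypothesis (bad block, ≥ 3 relays, drift, and goodness of every
quadruple on a weighting with at most as many positive-degree vertices as `u`).**  See the module docstring.
[cite: KozmaNitzan2024, §3.2 (Thms 4–5 pp. 12–14), §5.3 (Conjecture 6, p. 34), Question 7 (p. 36)] -/
theorem goodStep_of_residualKernelIH
    (hresIH : ∀ (n : ℕ) (u : Sym2 (Fin n) → unitInterval) (A S : Finset (Fin n)) (b a₀ : Fin n)
      (sel : Finset (Fin n) → Fin n),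
      b ∈ A → Disjoint S A → 2 ≤ S.card → 4 ≤ A.card → (∀ W, sel W ∈ A) → a₀ ∈ A →
      (∀ a ∈ A, (prodBernoulli u).real (openConn a₀ b) ≤ (prodBernoulli u).real (openConn a b)) →
      (∀ v ∈ S, (prodBernoulli u).real (openConn v b) < (prodBernoulli u).real (openConn a₀ b)) →
      (∃ a ∈ A, (prodBernoulli (fun e : Sym2 (Fin n) =>
          if (∀ x ∈ e, x ∈ S) ∧ ¬ e.IsDiag then 1 else u e)).real (openConn a b) <
        (prodBernoulli (fun e : Sym2 (Fin n) => if (∀ x ∈ e, x ∈ S) ∧ ¬ e.IsDiag then 1 else u e)).real (openConn a₀ b)) →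
      (∀ w' : Sym2 (Fin n) → unitInterval,
        (Finset.univ.filter (fun v : Fin n => ∃ z : Fin n, 0 < (w' s(z, v) : ℝ))).card
          ≤ (Finset.univ.filter (fun v : Fin n => ∃ z : Fin n, 0 < (u s(z, v) : ℝ))).card →
        ∀ (A' : Finset (Fin n)) (o' b' : Fin n), b' ∈ A' → o' ∉ A' →
        ∀ (t : ℝ) (sel' : Finset (Fin n) → Fin n), (∀ W, sel' W ∈ A') →
          (∀ a ∈ A', 1 - t ≤ (prodBernoulli w').real (openConn a b')) →
          (prodBernoulli w').real ((⋃ a ∈ A', openConn o' a) ∩ (openConn o' b')ᶜ)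
            + ∑ W ∈ (Finset.univ : Finset (Finset (Fin n))).filter (fun W => o' ∈ W ∧ Disjoint W A'),
                (prodBernoulli w').real {ω : BondConfig (Fin n) | openCluster ω o' = (W : Set (Fin n))}
                  * (prodBernoulli w').real (openConnIn ((W : Set (Fin n))ᶜ) (sel' W) b')ᶜ
            ≤ t) →
      (prodBernoulli u).real (openConn a₀ b)
          + (prodBernoulli u).real ((openConn a₀ b)ᶜ ∩ (⋃ s ∈ S, openConn a₀ s) ∩ (⋃ s ∈ S, openConn s b))
        ≤ (prodBernoulli u).real (⋃ s ∈ S, openConn s b)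
          + ∑ W ∈ (Finset.univ : Finset (Finset (Fin n))).filter (fun W => Disjoint W A),
              (prodBernoulli u).real {ω : BondConfig (Fin n) | ∀ z : Fin n, (z ∈ W ↔ ω ∈ ⋃ s ∈ S, openConn s z)}
                * (prodBernoulli u).real (openConnIn ((W : Set (Fin n))ᶜ) (sel W) b)) :
    ∀ (n : ℕ) (w : Sym2 (Fin n) → unitInterval) (A : Finset (Fin n)) (o b : Fin n),
      b ∈ A → o ∉ A →
      (∃ y : Fin n, y ∉ A ∧ y ≠ o ∧ (w s(o, y) : ℝ) ≠ 0) →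
      (∀ w' : Sym2 (Fin n) → unitInterval,
        (Finset.univ.filter (fun v : Fin n => ∃ u : Fin n, 0 < (w' s(u, v) : ℝ))).card
          < (Finset.univ.filter (fun v : Fin n => ∃ u : Fin n, 0 < (w s(u, v) : ℝ))).card →
        ∀ (A' : Finset (Fin n)) (o' b' : Fin n), b' ∈ A' → o' ∉ A' →
        ∀ (t : ℝ) (sel : Finset (Fin n) → Fin n), (∀ W, sel W ∈ A') →
          (∀ a ∈ A', 1 - t ≤ (prodBernoulli w').real (openConn a b')) →
          (prodBernoulli w').real ((⋃ a ∈ A', openConn o' a) ∩ (openConn o' b')ᶜ)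
            + ∑ W ∈ (Finset.univ : Finset (Finset (Fin n))).filter (fun W => o' ∈ W ∧ Disjoint W A'),
                (prodBernoulli w').real {ω : BondConfig (Fin n) | openCluster ω o' = (W : Set (Fin n))}
                  * (prodBernoulli w').real (openConnIn ((W : Set (Fin n))ᶜ) (sel W) b')ᶜ
            ≤ t) →
      ∀ (t : ℝ) (sel : Finset (Fin n) → Fin n), (∀ W, sel W ∈ A) →
        (∀ a ∈ A, 1 - t ≤ (prodBernoulli w).real (openConn a b)) →
        (prodBernoulli w).real ((⋃ a ∈ A, openConn o a) ∩ (openConn o b)ᶜ)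
          + ∑ W ∈ (Finset.univ : Finset (Finset (Fin n))).filter (fun W => o ∈ W ∧ Disjoint W A),
              (prodBernoulli w).real {ω : BondConfig (Fin n) | openCluster ω o = (W : Set (Fin n))}
                * (prodBernoulli w).real (openConnIn ((W : Set (Fin n))ᶜ) (sel W) b)ᶜ
          ≤ t := by
  intro n w A o b hb ho hlow IH
  obtain ⟨y₀, -, -, hy₀⟩ := id hlow
  refine goodStep24_main n w A o b hb ho hlow IH ?_
  intro S sel a₀ h2 hoS hSA hSw hsel ha₀ hmin hbad
  set K : Sym2 (Fin n) → unitInterval := fun e => if o ∈ e then (0 : unitInterval) else w e with hK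
  obtain ⟨s₀, hs₀⟩ := Finset.card_pos.1 (lt_of_lt_of_le zero_lt_two h2)
  have hs₀A : s₀ ∉ A := Finset.disjoint_left.1 hSA hs₀
  -- the induction hypothesis, available for every weighting with at most as many positive-degree vertices as `K`
  have hIHK : ∀ w' : Sym2 (Fin n) → unitInterval,
      (Finset.univ.filter (fun v : Fin n => ∃ z : Fin n, 0 < (w' s(z, v) : ℝ))).card
        ≤ (Finset.univ.filter (fun v : Fin n => ∃ z : Fin n, 0 < (K s(z, v) : ℝ))).card →
      ∀ (A' : Finset (Fin n)) (o' b' : Fin n), b' ∈ A' → o' ∉ A' →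
      ∀ (t : ℝ) (sel' : Finset (Fin n) → Fin n), (∀ W, sel' W ∈ A') →
        (∀ a ∈ A', 1 - t ≤ (prodBernoulli w').real (openConn a b')) →
        (prodBernoulli w').real ((⋃ a ∈ A', openConn o' a) ∩ (openConn o' b')ᶜ)
          + ∑ W ∈ (Finset.univ : Finset (Finset (Fin n))).filter (fun W => o' ∈ W ∧ Disjoint W A'),
              (prodBernoulli w').real {ω : BondConfig (Fin n) | openCluster ω o' = (W : Set (Fin n))}
                * (prodBernoulli w').real (openConnIn ((W : Set (Fin n))ᶜ) (sel' W) b')ᶜ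
          ≤ t :=
    fun w' hw' => IH w' (lt_of_le_of_lt hw' (goodStep24_card_lt w o y₀ hy₀))
  -- the goal in un-glued form (H3)
  rw [blockGrowth_glue_real_openConn, blockGrowth_glue_real_iUnion K S b]
  simp only [blockGrowth_glue_real_pocket K S]
  by_cases hA3 : A.card ≤ 3
  · -- at most two relays besides the target: the drift theorem
    exact blockGood_cardLeThree K A S b a₀ (fun W' => sel (insert o W')) hb ha₀ hA3 ⟨s₀, hs₀⟩ (fun W' => hsel _) hmin
  by_cases hfree : ∀ a ∈ A, (prodBernoulli (fun e : Sym2 (Fin n) =>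
      if (∀ x ∈ e, x ∈ S) ∧ ¬ e.IsDiag then 1 else K e)).real (openConn a₀ b) ≤
    (prodBernoulli (fun e : Sym2 (Fin n) => if (∀ x ∈ e, x ∈ S) ∧ ¬ e.IsDiag then 1 else K e)).real (openConn a b)
  · -- no drift: the induction hypothesis for the glued quadruple
    have hgood := IH (fun e : Sym2 (Fin n) => if (∀ x ∈ e, x ∈ S) ∧ ¬ e.IsDiag then 1 else K e)
      (driftFree_card_lt w S o y₀ hoS hy₀ hSw) A s₀ b hb hs₀A
    exact blockGood_leaf_ih K A S b a₀ s₀ (fun W' => sel (insert o W')) hs₀ hb (fun W' => hsel _) hfree hgood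
  · -- the residue, now with the induction hypothesis handed over
    push Not at hA3 hfree
    obtain ⟨a, ha, hlt⟩ := hfree
    exact hresIH n K A S b a₀ (fun W' => sel (insert o W')) hb hSA h2 (by omega) (fun W' => hsel _) ha₀ hmin hbad
      ⟨a, ha, hlt⟩ hIHK

/-- The residual kernel WITHOUT induction hypothesis (`hres` of `goodStep_of_residualKernel`) implies the residual kernel WITH
induction hypothesis (`hresIH` of `goodStep_of_residualKernelIH`): the extra hypothesis is simply dropped.  So registering the
IH-form as the open stub costs nothing. [folklore] -/
theorem residualKernelIH_of_residualKernel
    (hres : ∀ (n : ℕ) (u : Sym2 (Fin n) → unitInterval) (A S : Finset (Fin n)) (b a₀ : Fin n)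
      (sel : Finset (Fin n) → Fin n),
      b ∈ A → Disjoint S A → 2 ≤ S.card → 4 ≤ A.card → (∀ W, sel W ∈ A) → a₀ ∈ A →
      (∀ a ∈ A, (prodBernoulli u).real (openConn a₀ b) ≤ (prodBernoulli u).real (openConn a b)) →
      (∀ v ∈ S, (prodBernoulli u).real (openConn v b) < (prodBernoulli u).real (openConn a₀ b)) →
      (∃ a ∈ A, (prodBernoulli (fun e : Sym2 (Fin n) =>
          if (∀ x ∈ e, x ∈ S) ∧ ¬ e.IsDiag then 1 else u e)).real (openConn a b) <
        (prodBernoulli (fun e : Sym2 (Fin n) => if (∀ x ∈ e, x ∈ S) ∧ ¬ e.IsDiag then 1 else u e)).real (openConn a₀ b)) →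
      (prodBernoulli u).real (openConn a₀ b)
          + (prodBernoulli u).real ((openConn a₀ b)ᶜ ∩ (⋃ s ∈ S, openConn a₀ s) ∩ (⋃ s ∈ S, openConn s b))
        ≤ (prodBernoulli u).real (⋃ s ∈ S, openConn s b)
          + ∑ W ∈ (Finset.univ : Finset (Finset (Fin n))).filter (fun W => Disjoint W A),
              (prodBernoulli u).real {ω : BondConfig (Fin n) | ∀ z : Fin n, (z ∈ W ↔ ω ∈ ⋃ s ∈ S, openConn s z)}
                * (prodBernoulli u).real (openConnIn ((W : Set (Fin n))ᶜ) (sel W) b)) :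
    ∀ (n : ℕ) (u : Sym2 (Fin n) → unitInterval) (A S : Finset (Fin n)) (b a₀ : Fin n)
      (sel : Finset (Fin n) → Fin n),
      b ∈ A → Disjoint S A → 2 ≤ S.card → 4 ≤ A.card → (∀ W, sel W ∈ A) → a₀ ∈ A →
      (∀ a ∈ A, (prodBernoulli u).real (openConn a₀ b) ≤ (prodBernoulli u).real (openConn a b)) →
      (∀ v ∈ S, (prodBernoulli u).real (openConn v b) < (prodBernoulli u).real (openConn a₀ b)) →
      (∃ a ∈ A, (prodBernoulli (fun e : Sym2 (Fin n) =>
          if (∀ x ∈ e, x ∈ S) ∧ ¬ e.IsDiag then 1 else u e)).real (openConn a b) <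
        (prodBernoulli (fun e : Sym2 (Fin n) => if (∀ x ∈ e, x ∈ S) ∧ ¬ e.IsDiag then 1 else u e)).real (openConn a₀ b)) →
      (∀ w' : Sym2 (Fin n) → unitInterval,
        (Finset.univ.filter (fun v : Fin n => ∃ z : Fin n, 0 < (w' s(z, v) : ℝ))).card
          ≤ (Finset.univ.filter (fun v : Fin n => ∃ z : Fin n, 0 < (u s(z, v) : ℝ))).card →
        ∀ (A' : Finset (Fin n)) (o' b' : Fin n), b' ∈ A' → o' ∉ A' →
        ∀ (t : ℝ) (sel' : Finset (Fin n) → Fin n), (∀ W, sel' W ∈ A') →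
          (∀ a ∈ A', 1 - t ≤ (prodBernoulli w').real (openConn a b')) →
          (prodBernoulli w').real ((⋃ a ∈ A', openConn o' a) ∩ (openConn o' b')ᶜ)
            + ∑ W ∈ (Finset.univ : Finset (Finset (Fin n))).filter (fun W => o' ∈ W ∧ Disjoint W A'),
                (prodBernoulli w').real {ω : BondConfig (Fin n) | openCluster ω o' = (W : Set (Fin n))}
                  * (prodBernoulli w').real (openConnIn ((W : Set (Fin n))ᶜ) (sel' W) b')ᶜ
            ≤ t) →
      (prodBernoulli u).real (openConn a₀ b)
          + (prodBernoulli u).real ((openConn a₀ b)ᶜ ∩ (⋃ s ∈ S, openConn a₀ s) ∩ (⋃ s ∈ S, openConn s b))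
        ≤ (prodBernoulli u).real (⋃ s ∈ S, openConn s b)
          + ∑ W ∈ (Finset.univ : Finset (Finset (Fin n))).filter (fun W => Disjoint W A),
              (prodBernoulli u).real {ω : BondConfig (Fin n) | ∀ z : Fin n, (z ∈ W ↔ ω ∈ ⋃ s ∈ S, openConn s z)}
                * (prodBernoulli u).real (openConnIn ((W : Set (Fin n))ᶜ) (sel W) b) :=
  fun n u A S b a₀ sel hb hSA h2 h4 hsel ha₀ hmin hbad hdrift _ =>
    hres n u A S b a₀ sel hb hSA h2 h4 hsel ha₀ hmin hbad hdrift

end ResidualIH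

open Literature.Probability.LatticeModels Literature.Probability.Percolation in
/-- Registered helper stub `stub_goodStepOfResidualKernelIH_xb` (invested seat xfam-b): `stub_goodStep` ⟸ the residual kernel WITH
the induction hypothesis inside (= `goodStep_of_residualKernelIH`).
[cite: KozmaNitzan2024, §3.2 (Thms 4–5 pp. 12–14), §5.3 (Conjecture 6, p. 34), Question 7 (p. 36)] -/
theorem stub_goodStepOfResidualKernelIH_xb : (∀ (n : ℕ) (u : Sym2 (Fin n) → unitInterval) (A S : Finset (Fin n)) (b a₀ : Fin n) (sel : Finset (Fin n) → Fin n), b ∈ A → Disjoint S A → 2 ≤ S.card → 4 ≤ A.card → (∀ W, sel W ∈ A) → a₀ ∈ A → (∀ a ∈ A, (prodBernoulli u).real (openConn a₀ b) ≤ (prodBernoulli u).real (openConn a b)) → (∀ v ∈ S, (prodBernoulli u).real (openConn v b) < (prodBernoulli u).real (openConn a₀ b)) → (∃ a ∈ A, (prodBernoulli (fun e : Sym2 (Fin n) => if (∀ x ∈ e, x ∈ S) ∧ ¬ e.IsDiag then 1 else u e)).real (openConn a b) < (prodBernoulli (fun e : Sym2 (Fin n) => if (∀ x ∈ e, x ∈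 S) ∧ ¬ e.IsDiag then 1 else u e)).real (openConn a₀ b)) → (∀ w' : Sym2 (Fin n) → unitInterval, (Finset.univ.filter (fun v : Fin n => ∃ z : Fin n, 0 < (w' s(z, v) : ℝ))).card ≤ (Finset.univ.filter (fun v : Fin n => ∃ z : Fin n, 0 < (u s(z, v) : ℝ))).card → ∀ (A' : Finset (Fin n)) (o' b' : Fin n), b' ∈ A' → o' ∉ A' → ∀ (t : ℝ) (sel' : Finset (Fin n) → Fin n), (∀ W, sel' W ∈ A') → (∀ a ∈ A', 1 - t ≤ (prodBernoulli w').real (openConn a b')) → (prodBernoulli w').real ((⋃ a ∈ A', openConn o' a) ∩ (openConn o' b')ᶜ) + ∑ W ∈ (Finset.univ : Finset (Finset (Fin n))).filter (fun W => o' ∈ W ∧ Disjoint W A'), (prodBernoulli w').real {ω : BondConfig (Fin n) | openCluster ω o' = (W : Set (Fin n))} * (prodBernoulli w').real (openConnIn ((W : Set (Fin n))ᶜ) (sel' W) b')ᶜ ≤ t) → (prodBernoulli u).real (openConn a₀ b) + (prodBernoulli u).real ((openConn a₀ b)ᶜ ∩ (⋃ s ∈ S, openConn a₀ s) ∩ (⋃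 s ∈ S, openConn s b)) ≤ (prodBernoulli u).real (⋃ s ∈ S, openConn s b) + ∑ W ∈ (Finset.univ : Finset (Finset (Fin n))).filter (fun W => Disjoint W A), (prodBernoulli u).real {ω : BondConfig (Fin n) | ∀ z : Fin n, (z ∈ W ↔ ω ∈ ⋃ s ∈ S, openConn s z)} * (prodBernoulli u).real (openConnIn ((W : Set (Fin n))ᶜ) (sel W) b)) → ∀ (n : ℕ) (w : Sym2 (Fin n) → unitInterval) (A : Finset (Fin n)) (o b : Fin n), b ∈ A → o ∉ A → (∃ y : Fin n, y ∉ A ∧ y ≠ o ∧ (w s(o, y) : ℝ) ≠ 0) → (∀ w' : Sym2 (Fin n) → unitInterval, (Finset.univ.filter (fun v : Fin n => ∃ u : Fin n, 0 < (w' s(u, v) : ℝ))).card < (Finset.univ.filter (fun v : Fin n => ∃ u : Fin n, 0 < (w s(u, v) : ℝ))).card → ∀ (A' : Finset (Fin n)) (o' b' : Fin n), b' ∈ A' → o' ∉ A' → ∀ (t : ℝ) (sel : Finset (Fin n) → Fin n), (∀ W, sel W ∈ A') → (∀ a ∈ A', 1 - t ≤ (prodBernoulli w').real (openConn a b')) →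 (prodBernoulli w').real ((⋃ a ∈ A', openConn o' a) ∩ (openConn o' b')ᶜ) + ∑ W ∈ (Finset.univ : Finset (Finset (Fin n))).filter (fun W => o' ∈ W ∧ Disjoint W A'), (prodBernoulli w').real {ω : BondConfig (Fin n) | openCluster ω o' = (W : Set (Fin n))} * (prodBernoulli w').real (openConnIn ((W : Set (Fin n))ᶜ) (sel W) b')ᶜ ≤ t) → ∀ (t : ℝ) (sel : Finset (Fin n) → Fin n), (∀ W, sel W ∈ A) → (∀ a ∈ A, 1 - t ≤ (prodBernoulli w).real (openConn a b)) → (prodBernoulli w).real ((⋃ a ∈ A, openConn o a) ∩ (openConn o b)ᶜ) + ∑ W ∈ (Finset.univ : Finset (Finset (Fin n))).filter (fun W => o ∈ W ∧ Disjoint W A), (prodBernoulli w).real {ω : BondConfig (Fin n) | openCluster ω o = (W : Set (Fin n))} * (prodBernoulli w).real (openConnIn ((W : Set (Fin n))ᶜ) (sel W) b)ᶜ ≤ t :=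
  goodStep_of_residualKernelIH

end

end Summit.CriticalPhenomena.PercolationContinuityZ3.Theorems
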